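import Literature.Analysis.FluidPDE.SteadyNavierStokesEnergy
import Literature.Analysis.FunctionSpaces.TorusSobolevSpaceProofs

/-!
# `TameRoughRigidity.GPEulerCoercive` (stmt-AnomalousDissipation-18400) — negative side: the rest state

Refuter birth-vetting of the crux `N = GPEulerCoercive` ("`f_GP` carries no stationary statistical solution of
the forced Euler equations in the FMRT class", `∀ μ, ¬ IsStationaryStatisticalSolution 0 f_GP μ`).

Small-model facts (no Theses statement is asserted here):

* `isStationaryStatisticalSolution_rest` — the FMRT class of stationary statistical solutions of FORCED EULER
  (`ν = 0`, FMRT 2001 Ch. IV Def. 1.3) is INHABITED in the tree's formalisation: the Dirac mass at the rest state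
  is a stationary statistical solution of Euler with zero force. So the conclusion shape
  `¬ IsStationaryStatisticalSolution 0 f μ` of the crux is not junk-true, and
* `not_eulerCoercive_all_forces` — the pin `f = f_GP` is load-bearing: the un-pinned universal statement
  `∀ f μ, ¬ IsStationaryStatisticalSolution 0 f μ` is false.

The kill path for the crux itself is `Torus.isStationaryStatisticalSolution_dirac_holds` at `ν = 0` fed with ONE
steady `H`-weak Euler state `u ∈ V` of `P(u·∇u) = f_GP` (cf. `GPStatisticalRigidity.Negative.EulerSSS`); none is
known (parent crux census: no exact finite-mode dodger on the searched supports).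
-/

noncomputable section

open MeasureTheory
open scoped InnerProductSpace

set_option linter.dupNamespace false

namespace Summit.AnomalousDissipation.AnomalousDissipation.Theorems.GPEulerCoercive.Negative

open Literature.Analysis.FunctionSpaces Literature.Analysis.FunctionSpaces.Torus Literature.Analysis.FluidPDE

/-- The zero field on `T³` is divergence free. [folklore] -/
theorem isDivFree_zero : IsDivFree (0 : UnitAddTorus (Fin 3) → EuclideanSpace ℝ (Fin 3)) := by
  intro x
  simp [Literature.Analysis.FunctionSpaces.Torus.divergence, Literature.Analysis.FunctionSpaces.Torus.partialDeriv,
    Literature.Analysis.FunctionSpaces.Torus.lineDeriv]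

/-- The zero field on `T³` has zero mean. [folklore] -/
theorem hasZeroMean_zero : HasZeroMean (0 : UnitAddTorus (Fin 3) → EuclideanSpace ℝ (Fin 3)) := by
  simp [HasZeroMean]

/-- The zero field on `T³` is smooth. [folklore] -/
theorem isSmooth_zero : IsSmooth (0 : UnitAddTorus (Fin 3) → EuclideanSpace ℝ (Fin 3)) := isSmooth_const (0 : EuclideanSpace ℝ (Fin 3))

/-- `0 ∈ 𝒱` (as an `L²` class). [folklore] -/
theorem zero_mem_smoothSolenoidal : (0 : Lp (EuclideanSpace ℝ (Fin 3)) 2 (volume : Measure (UnitAddTorus (Fin 3)))) ∈ smoothSolenoidal (Fin 3) :=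
  ⟨0, isSmooth_zero, isDivFree_zero, hasZeroMean_zero, Lp.coeFn_zero (EuclideanSpace ℝ (Fin 3)) 2 volume⟩

/-- The rest state lies in `V = H ∩ H¹`. [folklore] -/
theorem zero_mem_energySpaceV :
    ((0 : energySpace (Fin 3)) : Lp (EuclideanSpace ℝ (Fin 3)) 2 (volume : Measure (UnitAddTorus (Fin 3)))) ∈ energySpaceV (Fin 3) := by
  rw [ZeroMemClass.coe_zero]
  exact smoothSolenoidal_subset_energySpaceV_holds zero_mem_smoothSolenoidal

/-- The representative of the rest state vanishes a.e. [folklore] -/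
theorem coe_zero_ae : (((0 : energySpace (Fin 3)) : Lp (EuclideanSpace ℝ (Fin 3)) 2 (volume : Measure (UnitAddTorus (Fin 3)))) : UnitAddTorus (Fin 3) → EuclideanSpace ℝ (Fin 3)) =ᵐ[volume] 0 := by
  rw [ZeroMemClass.coe_zero]
  exact Lp.coeFn_zero (EuclideanSpace ℝ (Fin 3)) 2 volume

/-- The rest state is a steady `H`-weak solution of the unforced Euler equations (`ν = 0`, `f = 0`). [folklore] -/
theorem isSteadyWeakSolution_rest :
    Torus.IsSteadyWeakSolution 0 (0 : UnitAddTorus (Fin 3) → EuclideanSpace ℝ (Fin 3)) (0 : energySpace (Fin 3)) := by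
  intro w _hw _hdiv _hmean
  unfold Torus.nsGeneratorPairing Torus.inertialPairing
  simp only [Pi.zero_apply, inner_zero_left, integral_zero, zero_mul, add_zero, zero_add]
  refine integral_eq_zero_of_ae ?_
  filter_upwards [coe_zero_ae] with x hx
  rw [hx]
  simp

/-- `0 ∈ L²(T³; ℝ³)`. [folklore] -/
theorem memLp_zero : MemLp (0 : UnitAddTorus (Fin 3) → EuclideanSpace ℝ (Fin 3)) 2 (volume : Measure (UnitAddTorus (Fin 3))) := MemLp.zero

/-- `card (Fin 3) ≤ 4`. [folklore] -/
theorem card_fin_three_le_four : Fintype.card (Fin 3) ≤ 4 := by simp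

set_option maxHeartbeats 1000000 in
/-- **The FMRT forced-Euler class is inhabited.** The Dirac mass at the rest state is a stationary statistical
solution of the Euler equations (`ν = 0`) with zero force (FMRT 2001, Ch. IV Def. 1.3 with the remark preceding
it: Dirac masses at stationary solutions; here via the tree's `isStationaryStatisticalSolution_dirac_holds`).
[folklore] -/
theorem isStationaryStatisticalSolution_rest :
    Torus.IsStationaryStatisticalSolution 0 (0 : UnitAddTorus (Fin 3) → EuclideanSpace ℝ (Fin 3)) (Measure.dirac (0 : energySpace (Fin 3))) := by
  have h := @Torus.isStationaryStatisticalSolution_dirac_holds (Fin 3) _ _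
  unfold Torus.isStationaryStatisticalSolution_dirac at h
  exact h le_rfl memLp_zero card_fin_three_le_four zero_mem_energySpaceV isSteadyWeakSolution_rest

/-- **The pin `f = f_GP` of `GPEulerCoercive` is load-bearing**: Euler-coercivity fails for SOME admissible
force (the zero force, witnessed by the rest state), so the crux is a statement about `f_GP`, not about the
FMRT class. [folklore] -/
theorem not_eulerCoercive_all_forces :
    ¬ ∀ (f : UnitAddTorus (Fin 3) → EuclideanSpace ℝ (Fin 3)) (μ : Measure (energySpace (Fin 3))), ¬ Torus.IsStationaryStatisticalSolution 0 f μ :=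
  fun h => h 0 _ isStationaryStatisticalSolution_rest

end Summit.AnomalousDissipation.AnomalousDissipation.Theorems.GPEulerCoercive.Negative
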